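import Summits.KontsevichZagierPeriods.KontsevichZagierPeriods.Theorems.RootDecompWalshStrataEtypeWalls
import Summits.KontsevichZagierPeriods.KontsevichZagierPeriods.Theorems.RootDecompWalshStrataQuadricWalls02
import Summits.KontsevichZagierPeriods.KontsevichZagierPeriods.Theorems.RootDecompWalshStrataCellThree01

/-!
# Root decomposition & Walsh strata — E-type assembly II: affine images, elliptic representations, the wall locus, generic atoms (gen 9, §41)

Route `RootDecompWalshStrata`, leaf `QuadricBakerDescent` (stmt-27597), residual R-E2 = the E-type ASSEMBLY
(NODE.md, decomp-kz-lens-4, GEN 9 MENU (1)).  Images of open / bounded / `ℚ`-semialgebraic planar sets under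
rational affine maps; representations `[U, γ√(a(κ₀X² + κ₁Y²) + c)]` on bounded sets; the WALL LOCUS of a
piece (radicand zero, genuine rational lines, adapted conic walls `R = q²`) with its transport along affine
maps and its behaviour under a cut by a rational line; openness and frontier of a generic sign atom of a
conic family.  [KontsevichZagier2001 §1.2 rules (1)–(2); BCR1998 §2.2; this node]
-/

noncomputable section

open Set MeasureTheory MvPolynomial Literature.NumberTheory.Transcendental
open Literature.ModelTheory.ExponentialFields (IsSemialgebraic)

namespace Summit.KontsevichZagierPeriods.RootDecompWalshStrata.ConicDescent.BallCube

variable {κ₀ κ₁ : ℚ}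

/-! #### 41.1 Images of planar sets under rational affine maps -/

namespace AffMap

variable (M : AffMap)

/-- Auxiliary step `continuous_toFun`. [bookkeeping] -/
theorem continuous_toFun : Continuous M.toFun :=
  continuous_iff_continuousAt.2 fun p => (M.hasFDerivAt_toFun p).continuousAt

/-- Auxiliary step `isOpen_image`. [bookkeeping] -/
theorem isOpen_image (hdet : M.det ≠ 0) {U : Set (Fin 2 → ℝ)} (hU : IsOpen U) : IsOpen (M.toFun '' U) := by
  rw [M.image_toFun hdet]
  exact hU.preimage M.inv.continuous_toFun

/-- The image of a `ℚ`-semialgebraic set under a rational affine map is `ℚ`-semialgebraic.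
[BCR1998 Prop. 2.2.7] -/
theorem isSemialgebraic_image {U : Set (Fin 2 → ℝ)} (hU : IsSemialgebraic ℚ U) :
    IsSemialgebraic ℚ (M.toFun '' U) :=
  IsSemialgebraicMapOn.isSemialgebraic_image_holds (M.isSemialgebraicMapOn_toFun hU) subset_rfl hU

/-- Auxiliary step `isBounded_image`. [bookkeeping] -/
theorem isBounded_image {U : Set (Fin 2 → ℝ)} (hU : Bornology.IsBounded U) :
    Bornology.IsBounded (M.toFun '' U) :=
  (hU.isCompact_closure.image M.continuous_toFun).isBounded.subset (image_mono subset_closure)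

/-- A point of `closure (M U) ∖ M U` comes from a point of `closure U ∖ U`. [folklore] -/
theorem inv_mem_closure_diff (hdet : M.det ≠ 0) {U : Set (Fin 2 → ℝ)} {w : Fin 2 → ℝ}
    (h1 : w ∈ closure (M.toFun '' U)) (h2 : w ∉ M.toFun '' U) :
    M.inv.toFun w ∈ closure U ∧ M.inv.toFun w ∉ U := by
  rw [M.image_toFun hdet] at h1 h2
  exact ⟨M.inv.continuous_toFun.closure_preimage_subset U h1, h2⟩

end AffMap

/-- A piece of `{κ₀X² + κ₁Y² < 1}` (`κ₀, κ₁ > 0`) is bounded. [folklore] -/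
theorem isBounded_of_subset_ell (hκ : 0 < κ₀ ∧ 0 < κ₁) {U : Set (Fin 2 → ℝ)}
    (hU : U ⊆ {w | (κ₀ : ℝ) * w 0 ^ 2 + κ₁ * w 1 ^ 2 < 1}) : Bornology.IsBounded U := by
  have hκ0 : (0 : ℝ) < κ₀ := by exact_mod_cast hκ.1
  have hκ1 : (0 : ℝ) < κ₁ := by exact_mod_cast hκ.2
  set R : ℝ := 1 / κ₀ + 1 / κ₁ + 1 with hR
  have hR0 : 0 ≤ R := by positivity
  refine (Metric.isBounded_Icc (fun _ : Fin 2 => -R) (fun _ : Fin 2 => R)).subset fun w hw => ?_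
  have hq := hU hw
  simp only [mem_setOf_eq] at hq
  have h0 : w 0 ^ 2 ≤ R ^ 2 := by
    have : w 0 ^ 2 < 1 / κ₀ := by
      rw [lt_div_iff₀ hκ0]; nlinarith [mul_nonneg hκ1.le (sq_nonneg (w 1))]
    nlinarith [one_div_pos.2 hκ0, one_div_pos.2 hκ1]
  have h1 : w 1 ^ 2 ≤ R ^ 2 := by
    have : w 1 ^ 2 < 1 / κ₁ := by
      rw [lt_div_iff₀ hκ1]; nlinarith [mul_nonneg hκ0.le (sq_nonneg (w 0))]
    nlinarith [one_div_pos.2 hκ0, one_div_pos.2 hκ1]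
  have ha0 : |w 0| ≤ R := by simpa only [abs_of_nonneg hR0] using sq_le_sq.1 h0
  have ha1 : |w 1| ≤ R := by simpa only [abs_of_nonneg hR0] using sq_le_sq.1 h1
  refine ⟨fun j => ?_, fun j => ?_⟩ <;> fin_cases j
  · exact (abs_le.1 ha0).1
  · exact (abs_le.1 ha1).1
  · exact (abs_le.1 ha0).2
  · exact (abs_le.1 ha1).2

/-! #### 41.2 Representations with the elliptic weight -/

/-- The elliptic weight is a `ℚ`-semialgebraic function on every `ℚ`-semialgebraic planar set. [BCR1998 §2.2] -/
theorem isSemialgebraicFunOn_ellW {s : Set (Fin 2 → ℝ)} (hs : IsSemialgebraic ℚ s) (κ₀ κ₁ γ a c : ℚ) :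
    IsSemialgebraicFunOn ℚ s (ellW κ₀ κ₁ γ a c) :=
  ((isSemialgebraicFunOn_ratCast hs γ).mul_holds (IsSemialgebraicFunOn.sqrt_holds
    (isSemialgebraicFunOn_aeval hs
      (C a * (C κ₀ * X 0 ^ 2 + C κ₁ * X 1 ^ 2) + C c : MvPolynomial (Fin 2) ℚ)))).congr
    fun w _ => by
      simp only [ellW, Pi.mul_apply, map_add, map_mul, map_pow, MvPolynomial.aeval_C,
        MvPolynomial.aeval_X, eq_ratCast]

/-- A bound for the elliptic weight on a box. [bookkeeping] -/
theorem abs_ellW_le (κ₀ κ₁ γ a c : ℚ) {R : ℝ} {w : Fin 2 → ℝ} (hw : ∀ j, |w j| ≤ R) :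
    |ellW κ₀ κ₁ γ a c w| ≤ |(γ : ℝ)| * √(|(a : ℝ)| * ((|(κ₀ : ℝ)| + |(κ₁ : ℝ)|) * R ^ 2) + |(c : ℝ)|) := by
  rw [ellW, abs_mul, abs_of_nonneg (Real.sqrt_nonneg _)]
  refine mul_le_mul_of_nonneg_left (Real.sqrt_le_sqrt ?_) (abs_nonneg _)
  have h0 : w 0 ^ 2 ≤ R ^ 2 := sq_le_sq' (abs_le.1 (hw 0)).1 (abs_le.1 (hw 0)).2
  have h1 : w 1 ^ 2 ≤ R ^ 2 := sq_le_sq' (abs_le.1 (hw 1)).1 (abs_le.1 (hw 1)).2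
  have e0 : |(κ₀ : ℝ) * w 0 ^ 2| ≤ |(κ₀ : ℝ)| * R ^ 2 := by
    rw [abs_mul, abs_of_nonneg (sq_nonneg (w 0))]
    exact mul_le_mul_of_nonneg_left h0 (abs_nonneg _)
  have e1 : |(κ₁ : ℝ) * w 1 ^ 2| ≤ |(κ₁ : ℝ)| * R ^ 2 := by
    rw [abs_mul, abs_of_nonneg (sq_nonneg (w 1))]
    exact mul_le_mul_of_nonneg_left h1 (abs_nonneg _)
  have eQ : |(κ₀ : ℝ) * w 0 ^ 2 + κ₁ * w 1 ^ 2| ≤ (|(κ₀ : ℝ)| + |(κ₁ : ℝ)|) * R ^ 2 :=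
    (abs_add_le _ _).trans (by linarith)
  have eA : |(a : ℝ) * (κ₀ * w 0 ^ 2 + κ₁ * w 1 ^ 2)| ≤ |(a : ℝ)| * ((|(κ₀ : ℝ)| + |(κ₁ : ℝ)|) * R ^ 2) := by
    rw [abs_mul]
    exact mul_le_mul_of_nonneg_left eQ (abs_nonneg _)
  calc (a : ℝ) * (κ₀ * w 0 ^ 2 + κ₁ * w 1 ^ 2) + c
      ≤ |(a : ℝ) * (κ₀ * w 0 ^ 2 + κ₁ * w 1 ^ 2)| + |(c : ℝ)| :=
        add_le_add (le_abs_self _) (le_abs_self _)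
    _ ≤ _ := by linarith

/-- **A representation `[U, γ√(a(κ₀X² + κ₁Y²) + c)]` exists on every bounded `ℚ`-semialgebraic `U`.**
[KontsevichZagier2001 §1.1] -/
theorem exists_ellRep {U : Set (Fin 2 → ℝ)} (hUs : IsSemialgebraic ℚ U) (hUb : Bornology.IsBounded U)
    (κ₀ κ₁ γ a c : ℚ) :
    ∃ τ : KZ.IntegralRep 2, τ.domain = U ∧ ∀ w ∈ τ.domain, τ.integrand w = ellW κ₀ κ₁ γ a c w := by
  obtain ⟨R, hR⟩ := isBounded_iff_forall_norm_le.1 hUb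
  have hw : ∀ w ∈ U, ∀ j, |w j| ≤ R := fun w hw j => by
    rw [← Real.norm_eq_abs]; exact (norm_le_pi_norm w j).trans (hR w hw)
  exact ⟨bddRep U hUs hUb (ellW κ₀ κ₁ γ a c) (isSemialgebraicFunOn_ellW hUs κ₀ κ₁ γ a c) _
    fun w hw' => abs_ellW_le κ₀ κ₁ γ a c (hw w hw'), rfl, fun _ _ => rfl⟩

/-! #### 41.3 The wall locus of a piece: transport and cuts -/

/-- The WALL LOCUS for the radicand `R`, the rational lines `ℓ` and the adapted conic walls `q`: the points on
`R = 0`, on a GENUINE listed line, or on a listed conic wall `R = q²`.  The frontier condition of an open piece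
`U` is `closure U ∖ U ⊆ wallLocus R ℓ q`. -/
def wallLocus (R : (Fin 2 → ℝ) → ℝ) {n m : ℕ} (ℓ : Fin n → Wall) (q : Fin m → Wall) : Set (Fin 2 → ℝ) :=
  {w | R w = 0 ∨ (∃ i, ((ℓ i).k1 ≠ 0 ∨ (ℓ i).k2 ≠ 0) ∧ (ℓ i).eval (w 0) (w 1) = 0) ∨
    ∃ j, R w = ((q j).eval (w 0) (w 1)) ^ 2}

section wallLocus

variable {R R' : (Fin 2 → ℝ) → ℝ} {n m : ℕ} {ℓ ℓ' : Fin n → Wall} {q q' : Fin m → Wall}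
  {U : Set (Fin 2 → ℝ)}

/-- Auxiliary step `mem_wallLocus`. [bookkeeping] -/
theorem mem_wallLocus {w : Fin 2 → ℝ} : w ∈ wallLocus R ℓ q ↔
    R w = 0 ∨ (∃ i, ((ℓ i).k1 ≠ 0 ∨ (ℓ i).k2 ≠ 0) ∧ (ℓ i).eval (w 0) (w 1) = 0) ∨
      ∃ j, R w = ((q j).eval (w 0) (w 1)) ^ 2 := Iff.rfl

/-- TRANSPORT of the frontier condition along an invertible rational affine map. [this node] -/
theorem wallLocus_transport (M : AffMap) (hdet : M.det ≠ 0) (hR : ∀ p, R' (M.toFun p) = R p)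
    (hℓ : ∀ i p, (ℓ' i).eval (M.toFun p 0) (M.toFun p 1) = (ℓ i).eval (p 0) (p 1))
    (hℓg : ∀ i, ((ℓ i).k1 ≠ 0 ∨ (ℓ i).k2 ≠ 0) → ((ℓ' i).k1 ≠ 0 ∨ (ℓ' i).k2 ≠ 0))
    (hq : ∀ j p, (q' j).eval (M.toFun p 0) (M.toFun p 1) = (q j).eval (p 0) (p 1))
    (h : ∀ w ∈ closure U, w ∉ U → w ∈ wallLocus R ℓ q) :
    ∀ w ∈ closure (M.toFun '' U), w ∉ M.toFun '' U → w ∈ wallLocus R' ℓ' q' := by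
  intro w hwc hwU
  obtain ⟨hpc, hpU⟩ := M.inv_mem_closure_diff hdet hwc hwU
  have hw : M.toFun (M.inv.toFun w) = w := M.toFun_inv hdet w
  rw [← hw]
  rcases h _ hpc hpU with h0 | ⟨i, hg, hi⟩ | ⟨j, hj⟩
  · exact Or.inl (by rw [hR]; exact h0)
  · exact Or.inr (Or.inl ⟨i, hℓg i hg, by rw [hℓ]; exact hi⟩)
  · exact Or.inr (Or.inr ⟨j, by rw [hR, hq]; exact hj⟩)

/-- CUTTING by a genuine rational line: the piece `U ∩ P`, where the closure of `P` stays inside `P` up to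
the line, satisfies the frontier condition with the line added to the list. [this node] -/
theorem wallLocus_inter (L : Wall) (hL : L.k1 ≠ 0 ∨ L.k2 ≠ 0) {P : Set (Fin 2 → ℝ)}
    (hP : ∀ w ∈ closure P, w ∈ P ∨ L.eval (w 0) (w 1) = 0)
    (h : ∀ w ∈ closure U, w ∉ U → w ∈ wallLocus R ℓ q) :
    ∀ w ∈ closure (U ∩ P), w ∉ U ∩ P → w ∈ wallLocus R (Fin.cons L ℓ) q := by
  intro w hwc hwU
  by_cases hU : w ∈ U
  · have hwP : w ∉ P := fun h' => hwU ⟨hU, h'⟩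
    rcases hP w (closure_mono inter_subset_right hwc) with h' | h0
    · exact absurd h' hwP
    · exact Or.inr (Or.inl ⟨0, by simpa only [Fin.cons_zero] using hL,
        by simpa only [Fin.cons_zero] using h0⟩)
  · rcases h w (closure_mono inter_subset_left hwc) hU with h0 | ⟨i, hg, hi⟩ | ⟨j, hj⟩
    · exact Or.inl h0
    · exact Or.inr (Or.inl ⟨i.succ, by simpa only [Fin.cons_succ] using hg,
        by simpa only [Fin.cons_succ] using hi⟩)
    · exact Or.inr (Or.inr ⟨j, hj⟩)

end wallLocus

/-- The half-planes of a rational line are admissible cuts for `wallLocus_inter`. [folklore] -/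
theorem closure_pos_wall (L : Wall) :
    ∀ w ∈ closure {w : Fin 2 → ℝ | 0 < L.eval (w 0) (w 1)},
      w ∈ {w : Fin 2 → ℝ | 0 < L.eval (w 0) (w 1)} ∨ L.eval (w 0) (w 1) = 0 := fun w hw => by
  have hc : Continuous fun w : Fin 2 → ℝ => L.eval (w 0) (w 1) := by
    simp only [Wall.eval]; fun_prop
  have hsub : {v : Fin 2 → ℝ | 0 < L.eval (v 0) (v 1)} ⊆ {v | 0 ≤ L.eval (v 0) (v 1)} :=
    fun v (hv : 0 < L.eval (v 0) (v 1)) => show 0 ≤ L.eval (v 0) (v 1) from hv.le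
  have hcl : IsClosed {v : Fin 2 → ℝ | 0 ≤ L.eval (v 0) (v 1)} := isClosed_le continuous_const hc
  have hle : 0 ≤ L.eval (w 0) (w 1) := closure_minimal hsub hcl hw
  rcases hle.eq_or_lt with h | h
  · exact Or.inr h.symm
  · exact Or.inl h

/-- Auxiliary step `closure_neg_wall`. [bookkeeping] -/
theorem closure_neg_wall (L : Wall) :
    ∀ w ∈ closure {w : Fin 2 → ℝ | L.eval (w 0) (w 1) < 0},
      w ∈ {w : Fin 2 → ℝ | L.eval (w 0) (w 1) < 0} ∨ L.eval (w 0) (w 1) = 0 := fun w hw => by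
  have hc : Continuous fun w : Fin 2 → ℝ => L.eval (w 0) (w 1) := by
    simp only [Wall.eval]; fun_prop
  have hsub : {v : Fin 2 → ℝ | L.eval (v 0) (v 1) < 0} ⊆ {v | L.eval (v 0) (v 1) ≤ 0} :=
    fun v (hv : L.eval (v 0) (v 1) < 0) => show L.eval (v 0) (v 1) ≤ 0 from hv.le
  have hcl : IsClosed {v : Fin 2 → ℝ | L.eval (v 0) (v 1) ≤ 0} := isClosed_le hc continuous_const
  have hle : L.eval (w 0) (w 1) ≤ 0 := closure_minimal hsub hcl hw
  rcases hle.eq_or_lt with h | h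
  · exact Or.inr h
  · exact Or.inl h

/-! #### 41.4 Generic sign atoms of a conic family: openness and frontier -/

/-- A sign atom none of whose `σ i = 0` conics is non-trivial is open. [folklore] -/
theorem isOpen_atomFam_generic {k : ℕ} (F : Fin k → Conic) (σ : Fin k → SignType)
    (hnull : ∀ i, σ i = 0 → ∀ v : Fin 2 → ℝ, (F i).pxy (v 0) (v 1) = 0) : IsOpen (atomFam F σ) := by
  have hsgn : ∀ s : SignType, s = 0 ∨ s = -1 ∨ s = 1 := fun s => by cases s <;> simp
  have hcont : ∀ i, Continuous fun v : Fin 2 → ℝ => (F i).pxy (v 0) (v 1) := fun i =>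
    (F i).continuous_pxy
  have hWeq : atomFam F σ = (⋂ j : Fin 2, {v : Fin 2 → ℝ | 0 < v j ∧ v j < 1}) ∩
      ⋂ i : Fin k, {v | SignType.sign ((F i).pxy (v 0) (v 1)) = σ i} := by
    ext v; simp only [atomFam, mem_setOf_eq, mem_inter_iff, mem_iInter]
  rw [hWeq]
  refine (isOpen_iInter_of_finite fun j => ?_).inter (isOpen_iInter_of_finite fun i => ?_)
  · exact (isOpen_lt continuous_const (continuous_apply j)).inter
      (isOpen_lt (continuous_apply j) continuous_const)
  · rcases hsgn (σ i) with h | h | h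
    · rw [show {v : Fin 2 → ℝ | SignType.sign ((F i).pxy (v 0) (v 1)) = σ i} = univ from
        eq_univ_of_forall fun v => by rw [mem_setOf_eq, hnull i h v, sign_zero, h]]
      exact isOpen_univ
    · simp only [h, sign_eq_neg_one_iff]; exact isOpen_lt (hcont i) continuous_const
    · simp only [h, sign_eq_one_iff]; exact isOpen_lt continuous_const (hcont i)

/-- **FRONTIER OF A GENERIC ATOM.**  A point of `closure (atomFam F σ) ∖ atomFam F σ` lies on an edge of
the square or on the zero set of a conic of the family with `σ i ≠ 0`. [this node] -/
theorem frontier_atomFam_generic {k : ℕ} (F : Fin k → Conic) (σ : Fin k → SignType)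
    (hnull : ∀ i, σ i = 0 → ∀ v : Fin 2 → ℝ, (F i).pxy (v 0) (v 1) = 0) {z : Fin 2 → ℝ}
    (hzc : z ∈ closure (atomFam F σ)) (hzW : z ∉ atomFam F σ) :
    (∃ j, z j = 0 ∨ z j = 1) ∨ ∃ i, σ i ≠ 0 ∧ (F i).pxy (z 0) (z 1) = 0 := by
  have hsgn : ∀ s : SignType, s = 0 ∨ s = -1 ∨ s = 1 := fun s => by cases s <;> simp
  have hcont : ∀ i, Continuous fun v : Fin 2 → ℝ => (F i).pxy (v 0) (v 1) := fun i =>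
    (F i).continuous_pxy
  have hWI : atomFam F σ ⊆ Icc 0 1 := fun v hv => ⟨fun j => (hv.1 j).1.le, fun j => (hv.1 j).2.le⟩
  have hzI : z ∈ Icc (0 : Fin 2 → ℝ) 1 := closure_minimal hWI isClosed_Icc hzc
  by_contra hcon
  simp only [not_or, not_exists, not_and] at hcon
  obtain ⟨hco, had⟩ := hcon
  apply hzW
  refine ⟨fun j => ⟨lt_of_le_of_ne (hzI.1 j) (fun h => (hco j).1 h.symm),
    lt_of_le_of_ne (hzI.2 j) (hco j).2⟩, fun i => ?_⟩
  rcases hsgn (σ i) with h | h | h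
  · rw [h, hnull i h z, sign_zero]
  · have hle : (F i).pxy (z 0) (z 1) ≤ 0 :=
      closure_minimal (fun v (hv : v ∈ atomFam F σ) =>
        show v ∈ {v : Fin 2 → ℝ | (F i).pxy (v 0) (v 1) ≤ 0} from
          (sign_eq_neg_one_iff.1 ((hv.2 i).trans h)).le)
        (isClosed_le (hcont i) continuous_const) hzc
    rw [h]
    exact sign_eq_neg_one_iff.2 (lt_of_le_of_ne hle (had i (by rw [h]; decide)))
  · have hle : 0 ≤ (F i).pxy (z 0) (z 1) :=
      closure_minimal (fun v (hv : v ∈ atomFam F σ) =>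
        show v ∈ {v : Fin 2 → ℝ | 0 ≤ (F i).pxy (v 0) (v 1)} from
          (sign_eq_one_iff.1 ((hv.2 i).trans h)).le)
        (isClosed_le continuous_const (hcont i)) hzc
    rw [h]
    exact sign_eq_one_iff.2 (lt_of_le_of_ne hle fun h0 => had i (by rw [h]; decide) h0.symm)

end Summit.KontsevichZagierPeriods.RootDecompWalshStrata.ConicDescent.BallCube

end
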